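import Summits.Ventures.CertifiedArithmetic.LowPrec.GemmThetaLawGenSem

/-!
# Letter-dependent symbolic θ-certificates: soundness of `psiLevel`, `target` and `closureOK`

HONEST FRAMING (venture CertifiedArithmetic / cell `pub-lowprec`, seat gemm, gen 12 → 13): certified
error envelopes and provably optimal rounding/accumulation schemes for low-precision formats under
stated cost models; every table by two implementations; no hardware or vendor claims.

Step (S2, second half) of the soundness chain for `GemmThetaLawGenDefs.lean` (cell HANDOFF decision
35; `code/gemm/thetalaw/GENDEFS-CONTRACT.md` §2, §4): what the Option/Bool-valued symbolic functions
of the checker MEAN at every parameter `(K, T)` of a class domain (`IDom.mem`), with `M = M₀K = 2H =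
2^m`, `K` even.  `psiLevel_bin_sound` / `psiLevel_top_sound`: the ψ-form evaluates to the generic
potential `LawData.psiZ` of the vertex `(M + t')·u` (boundary `t' = M` included, by `contOK`);
`target_xpos_sound` / `target_xneg_sound` / `target_bin_sound`: the symbolic step's result form IS
the integer round-to-nearest-even of the exact sum (`rneSigMag`, via `tryBinadeI_sound` of
`GemmThetaLawSymI`), with its level data; `closureOK_sound`: the result's trailing significand lies
in the level's range.  These remove all Option/Bool plumbing from the edge-soundness step (S3).
-/

namespace Literature.ComputerArithmetic.FloatingPoint

namespace MiniFloat

namespace ThetaLaw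

namespace LawData

variable (L : LawData)

open AForm

/-! ### `psiLevel` -/

/-- On level `Q` the ψ-form is the trailing-significand form itself. [cell] -/
theorem psiLevel_Q (tf : AForm) (d : IDom) : L.psiLevel Lev.Q tf d = some tf := rfl

/-- SOUNDNESS OF `psiLevel` ON A BINADE `j ≤ J`: `0 ≤ t' ≤ M` on the domain and the form is the
potential of the vertex `(M + t')·2^(j+1)` (for `t' = M`: of the next level's first vertex).
[cell] -/
theorem psiLevel_bin_sound (hc : L.contOK = true) {m : ℕ} {H K T : ℤ} (hM : (2 : ℤ) ^ m = 2 * H)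
    (hMK : L.M0 * K = 2 * H) {d : IDom} (hd : d.mem K T) {j : ℕ} (hj : j ≤ L.J) {tf f : AForm}
    (h : L.psiLevel (Lev.bin j) tf d = some f) :
    0 ≤ tf.eval K T ∧ tf.eval K T ≤ 2 * H ∧
      f.eval K T = L.psiZ m ((2 * H + tf.eval K T) * 2 ^ (j + 1)) := by
  simp only [psiLevel] at h
  by_cases hb : (nonnegOnI d tf && nonnegOnI d ((hH L.M0).sub tf)) = true
  · rw [hb] at h
    simp only [Bool.not_true, Bool.false_eq_true, if_false] at h
    rw [Bool.and_eq_true] at hb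
    have h0 := nonnegOnI_sound hb.1 hd
    have h1 := nonnegOnI_sound hb.2 hd
    simp only [eval_sub, eval_hH] at h1
    have ht2 : tf.eval K T ≤ 2 * H := by linarith
    refine ⟨h0, ht2, ?_⟩
    rw [L.psiZ_vertex' hc hM (by omega) h0 ht2 (by omega)]
    by_cases hjJ : j = L.J
    · rw [if_pos hjJ] at h
      simp only [Option.some.injEq] at h
      subst h
      unfold psiBin
      rw [if_neg (by omega), if_pos hjJ]
      simp only [eval_add, eval_hH, eval_smul]
      rw [mul_assoc, hMK]
    · rw [if_neg hjJ] at h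
      split at h
      · rename_i ch hch
        simp only [Option.some.injEq] at h
        subst h
        unfold psiBin
        rw [if_pos (by omega)]
        simp only [eval_add, eval_hH, eval_smul, ceilHalf_sound hch]
        rw [mul_assoc, hMK]
      · exact absurd h (by simp)
  · rw [Bool.not_eq_true] at hb
    rw [hb] at h
    simp at h

/-- SOUNDNESS OF `psiLevel` AT THE TOP: `t' = 0` on the domain and the form is the potential of
the top vertex `M·2^(J+2)`. [cell] -/
theorem psiLevel_top_sound (hc : L.contOK = true) {m : ℕ} {H K T : ℤ} (hM : (2 : ℤ) ^ m = 2 * H)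
    (hMK : L.M0 * K = 2 * H) {d : IDom} (hd : d.mem K T) {tf f : AForm}
    (h : L.psiLevel Lev.top tf d = some f) :
    tf.eval K T = 0 ∧ f.eval K T = L.psiZ m ((2 * H + 0) * 2 ^ (L.J + 1 + 1)) := by
  simp only [psiLevel] at h
  obtain ⟨hb, h⟩ := Option.ite_none_right_eq_some.mp h
  simp only [Option.some.injEq] at h
  subst h
  rw [Bool.and_eq_true] at hb
  have h0 := nonnegOnI_sound hb.1 hd
  have h1 := nonnegOnI_sound hb.2 hd
  simp only [eval_smul] at h1
  have ht0 : tf.eval K T = 0 := by linarith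
  have hH0 : (0 : ℤ) ≤ 2 * H := by rw [← hM]; positivity
  refine ⟨ht0, ?_⟩
  rw [L.psiZ_vertex' hc hM le_rfl le_rfl hH0 (fun _ => rfl)]
  unfold psiBin
  rw [if_neg (by omega), if_neg (by omega)]
  simp only [eval_hH]
  rw [mul_assoc, hMK]

/-! ### `target` and `closureOK` -/

/-- SOUNDNESS OF `target`, exact positive result: the sum `n` satisfies `0 ≤ n ≤ 2M - 1` on the
domain (so it is exactly representable and the step is exact), and the result data are
`⟨n, Q, n, false⟩`. [cell] -/
theorem target_xpos_sound {K T : ℤ} {d : IDom} (hd : d.mem K T) {n : AForm} {tg : TgtI}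
    (h : L.target d n TCode.xpos = some tg) :
    tg = ⟨n, Lev.Q, n, false⟩ ∧ 0 ≤ n.eval K T ∧ n.eval K T ≤ 2 * L.M0 * K - 1 := by
  simp only [target] at h
  obtain ⟨hb, h⟩ := Option.ite_none_right_eq_some.mp h
  simp only [Option.some.injEq] at h
  rw [Bool.and_eq_true] at hb
  have h0 := nonnegOnI_sound hb.1 hd
  have h1 := nonnegOnI_sound hb.2 hd
  simp only [eval_sub, eval_hH, eval_const] at h1
  exact ⟨h.symm, h0, by linarith⟩

/-- SOUNDNESS OF `target`, exact negative result (sign flip): `-(2M - 1) ≤ n ≤ -1` on the domain,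
result data `⟨n, Q, -n, true⟩`. [cell] -/
theorem target_xneg_sound {K T : ℤ} {d : IDom} (hd : d.mem K T) {n : AForm} {tg : TgtI}
    (h : L.target d n TCode.xneg = some tg) :
    tg = ⟨n, Lev.Q, smul (-1) n, true⟩ ∧ n.eval K T ≤ -1 ∧ -(2 * L.M0 * K - 1) ≤ n.eval K T := by
  simp only [target] at h
  obtain ⟨hb, h⟩ := Option.ite_none_right_eq_some.mp h
  simp only [Option.some.injEq] at h
  rw [Bool.and_eq_true] at hb
  have h0 := nonnegOnI_sound hb.1 hd
  have h1 := nonnegOnI_sound hb.2 hd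
  simp only [eval_sub, eval_smul, eval_const] at h0
  simp only [eval_sub, eval_add, eval_hH, eval_const] at h1
  exact ⟨h.symm, by linarith, by linarith⟩

/-- SOUNDNESS OF `target`, rounded result in the binade of spacing `2^e` (`1 ≤ e ≤ J + 2`): the sum
is non-negative and its round-to-nearest-even to `m + 1` bits is `sig·2^e` with `M ≤ sig ≤ 2M`;
the result data are `⟨2^e·sig, levOfE e, sig - M, false⟩`. [cell] -/
theorem target_bin_sound {m : ℕ} {K T : ℤ} {d : IDom} (hd : d.mem K T) (hev : 2 ∣ K)
    (hM : (2 : ℤ) ^ m = L.M0 * K) {n : AForm} {e : ℕ} {tg : TgtI}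
    (h : L.target d n (TCode.bin e) = some tg) :
    ∃ sig : AForm, tg = ⟨smul (2 ^ e) sig, L.levOfE e, sig.sub (hH L.M0), false⟩ ∧ 1 ≤ e ∧
      e ≤ L.J + 2 ∧ L.M0 * K ≤ sig.eval K T ∧ sig.eval K T ≤ 2 * L.M0 * K ∧ 0 ≤ n.eval K T ∧
      ((rneSigMag m (n.eval K T).toNat : ℕ) : ℤ) = sig.eval K T * 2 ^ e := by
  simp only [target] at h
  by_cases hr : e < 1 ∨ L.J + 2 < e
  · rw [if_pos hr] at h; exact absurd h (by simp)
  · rw [if_neg hr] at h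
    simp only [not_or, not_lt] at hr
    obtain ⟨hr1, hr2⟩ := hr
    split at h
    · rename_i x sig htb
      simp only [Option.some.injEq] at h
      obtain ⟨sig', hs, h1, h2, h3, h4⟩ := tryBinadeI_sound htb hd hev hM
      simp only [Tgt.big.injEq] at hs
      obtain ⟨-, rfl⟩ := hs
      exact ⟨sig, h.symm, by omega, by omega, h1, h2, h3, h4⟩
    · exact absurd h (by simp)

/-- SOUNDNESS OF `closureOK`: the result's trailing significand lies in its level's range on the
domain (`Q`: nothing; top: `t' = 0`; binade: `0 ≤ t' ≤ M`). [cell] -/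
theorem closureOK_sound {K T : ℤ} {d : IDom} (hd : d.mem K T) {tg : TgtI}
    (h : L.closureOK d tg = true) :
    (tg.lev = Lev.top → tg.tf.eval K T = 0) ∧
      (∀ j, tg.lev = Lev.bin j → 0 ≤ tg.tf.eval K T ∧ tg.tf.eval K T ≤ L.M0 * K) := by
  unfold closureOK at h
  constructor
  · intro ht
    rw [ht] at h
    simp only [Bool.and_eq_true] at h
    have h0 := nonnegOnI_sound h.1 hd
    have h1 := nonnegOnI_sound h.2 hd
    simp only [eval_smul] at h1
    linarith
  · intro j hj
    rw [hj] at h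
    simp only [Bool.and_eq_true] at h
    have h0 := nonnegOnI_sound h.1 hd
    have h1 := nonnegOnI_sound h.2 hd
    simp only [eval_sub, eval_hH] at h1
    exact ⟨h0, by linarith⟩

end LawData

end ThetaLaw

end MiniFloat

end Literature.ComputerArithmetic.FloatingPoint
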